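import Summits.CriticalPhenomena.CardyFormulaZ2.Theorems.CardyFlipRussoVoronoiHubFromSmirnovDelaunayPivot
import Mathlib.Analysis.SpecialFunctions.Sqrt
import Mathlib.Analysis.Calculus.LocalExtr.Basic

/-!
# Stub `pencil_localMax_dist_eq` of line `moebius-exact-delaunay-dilation-ward`
# (crux `VoronoiHubFromSmirnov`, stmt-CriticalPhenomena-6433)

THE FERMAT CASE OF THE PENCIL ANALYSIS (I. Benjamini, O. Schramm, *Conformal invariance of Voronoi
percolation*, Comm. Math. Phys. 197 (1998), Lemma 4.2).  Fix `p ≠ q` in the plane and the pencil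
of centres equidistant from `p` and `q`,

  `c t = p + (1/2 + t i) (q − p)`,   `t : ℝ`,

with radius `R t = dist p (c t) = dist q (c t)` and, for a competitor `d`, clearance
`D t − R t`, `D t = dist d (c t)`.  If at a parameter `t₀` the competitor is outside the closed
disc's interior (`R t₀ ≤ D t₀`) and the clearance `t ↦ D t − R t` has a local maximum at `t₀`,
then `d` lies on the ray from `c t₀` through `p` beyond `p`, or on the ray through `q` beyond
`q`; equivalently `dist d p = D t₀ − R t₀` or `dist d q = D t₀ − R t₀`.

Proof (planar calculus and algebra only).  Write `v = q − p ≠ 0` and `d − c t₀ = u v` with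
`u = α + β i`.  Then `D t ^ 2 = ‖v‖² (α² + (β + t₀ − t)²)` and `R t ^ 2 = ‖v‖² (1/4 + t²)` are
quadratic polynomials in `t`, positive at `t₀` (`0 < R t₀ ≤ D t₀`), so `D − R = √Q_d − √Q_p` is
differentiable at `t₀` (`HasDerivAt.sqrt`) and Fermat's rule (`IsLocalMax.hasDerivAt_eq_zero`)
gives `−β / D t₀ = t₀ / R t₀`, i.e. `β = −t₀ s` with `s = D t₀ / R t₀ ≥ 1`.  From
`D t₀ ² = ‖v‖² (α² + β²) = s² ‖v‖² (1/4 + t₀²)` we get `α² = s²/4`, so `α = ± s/2`: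
* `α = −s/2`: `d − c t₀ = s (p − c t₀)`, hence `d − p = (s − 1)(p − c t₀)` and
  `dist d p = (s − 1) R t₀ = D t₀ − R t₀`;
* `α = s/2`: `d − c t₀ = s (q − c t₀)`, hence `dist d q = (s − 1) R t₀ = D t₀ − R t₀`.

No new definitions.
-/

noncomputable section

namespace Summit.CriticalPhenomena.CardyFormulaZ2.Cruxes.VoronoiHubFromSmirnov.MoebiusExactDelaunayDilationWard

/-- Derivative of a real quadratic polynomial `A + B t + C t²` at `x` is `B + 2 C x`. [folklore] -/
theorem pf_hasDerivAt_quad (A B C x : ℝ) :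
    HasDerivAt (fun t : ℝ => A + B * t + C * t ^ 2) (B + 2 * C * x) x := by
  have h : HasDerivAt (fun t : ℝ => A + B * t + C * t ^ 2)
      (0 + B * 1 + C * (((2 : ℕ) : ℝ) * x ^ (2 - 1))) x :=
    ((hasDerivAt_const x A).add ((hasDerivAt_id' x).const_mul B)).add
      ((hasDerivAt_pow 2 x).const_mul C)
  convert h using 1
  rw [Nat.cast_ofNat, show (2 - 1 : ℕ) = 1 from rfl, pow_one]
  ring

/-- Squared radius of the pencil: `dist p (c t) ^ 2 = ‖q − p‖² (1/4 + t²)` for the centre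
`c t = p + (1/2 + t i)(q − p)`. [folklore] -/
theorem pf_dist_p_sq (p q : ℂ) (t : ℝ) :
    dist p (p + ((1/2 : ℂ) + (t : ℂ) * Complex.I) * (q - p)) ^ 2 =
      ‖q - p‖ ^ 2 * (1 / 4 + t ^ 2) := by
  rw [dist_comm, Complex.dist_eq, add_sub_cancel_left, norm_mul, mul_pow, mul_comm]
  congr 1
  rw [Complex.sq_norm, Complex.normSq_apply]
  simp only [Complex.add_re, Complex.add_im, Complex.mul_re, Complex.mul_im, Complex.ofReal_re,
    Complex.ofReal_im, Complex.I_re, Complex.I_im, Complex.div_ofNat_re, Complex.div_ofNat_im,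
    Complex.one_re, Complex.one_im]
  ring

/-- Every centre `c t = p + (1/2 + t i)(q − p)` of the pencil is equidistant from `p` and `q`
(version of `dp_dist_q` with the centre written `(1/2 : ℂ) + t * I`). [folklore] -/
theorem pf_dist_q (p q : ℂ) (t : ℝ) :
    dist q (p + ((1/2 : ℂ) + (t : ℂ) * Complex.I) * (q - p)) =
      dist p (p + ((1/2 : ℂ) + (t : ℂ) * Complex.I) * (q - p)) := by
  rw [← sq_eq_sq₀ dist_nonneg dist_nonneg, pf_dist_p_sq, dist_comm, Complex.dist_eq]
  have h : p + ((1/2 : ℂ) + (t : ℂ) * Complex.I) * (q - p) - q =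
      (-(1/2 : ℂ) + (t : ℂ) * Complex.I) * (q - p) := by ring
  rw [h, norm_mul, mul_pow, mul_comm]
  congr 1
  rw [Complex.sq_norm, Complex.normSq_apply]
  simp only [Complex.add_re, Complex.add_im, Complex.mul_re, Complex.mul_im, Complex.ofReal_re,
    Complex.ofReal_im, Complex.I_re, Complex.I_im, Complex.neg_re, Complex.neg_im,
    Complex.div_ofNat_re, Complex.div_ofNat_im, Complex.one_re, Complex.one_im]
  ring

/-- Squared distance from a competitor to the moving centre: if `d = c t₀ + u (q − p)` then
`dist d (c t) ^ 2 = ‖q − p‖² (u.re² + (u.im + t₀ − t)²)`. [folklore] -/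
theorem pf_dist_d_sq (p q : ℂ) (u : ℂ) (t₀ t : ℝ) :
    dist (p + ((1/2 : ℂ) + (t₀ : ℂ) * Complex.I) * (q - p) + u * (q - p))
        (p + ((1/2 : ℂ) + (t : ℂ) * Complex.I) * (q - p)) ^ 2 =
      ‖q - p‖ ^ 2 * (u.re ^ 2 + (u.im + t₀ - t) ^ 2) := by
  rw [Complex.dist_eq]
  have h : p + ((1/2 : ℂ) + (t₀ : ℂ) * Complex.I) * (q - p) + u * (q - p) -
      (p + ((1/2 : ℂ) + (t : ℂ) * Complex.I) * (q - p)) =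
      (u + ((t₀ - t : ℝ) : ℂ) * Complex.I) * (q - p) := by
    push_cast
    ring
  rw [h, norm_mul, mul_pow, mul_comm]
  congr 1
  rw [Complex.sq_norm, Complex.normSq_apply]
  simp only [Complex.add_re, Complex.add_im, Complex.mul_re, Complex.mul_im, Complex.ofReal_re,
    Complex.ofReal_im, Complex.I_re, Complex.I_im]
  ring

/-- **Core of the Fermat case**, with the pencil of centres abstracted as a function `c`
satisfying `c t = p + (1/2 + t i)(q − p)`. [folklore] -/
theorem pf_core {p q d : ℂ} {t₀ : ℝ} (c : ℝ → ℂ)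
    (hc : ∀ t, c t = p + ((1/2 : ℂ) + (t : ℂ) * Complex.I) * (q - p)) (hpq : p ≠ q)
    (hle : dist p (c t₀) ≤ dist d (c t₀))
    (hmax : IsLocalMax (fun t : ℝ => dist d (c t) - dist p (c t)) t₀) :
    dist d p = dist d (c t₀) - dist p (c t₀) ∨ dist d q = dist d (c t₀) - dist p (c t₀) := by
  have hv : q - p ≠ 0 := sub_ne_zero.mpr hpq.symm
  have hN : ‖q - p‖ ^ 2 ≠ 0 := pow_ne_zero 2 (norm_ne_zero_iff.mpr hv)
  -- the radius: its square, positivity, and `dist q (c t₀) = dist p (c t₀)`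
  have hR2 : ∀ t, dist p (c t) ^ 2 = ‖q - p‖ ^ 2 * (1 / 4 + t ^ 2) := fun t => by
    rw [hc, pf_dist_p_sq]
  have hRq : dist q (c t₀) = dist p (c t₀) := by rw [hc, pf_dist_q]
  have hR0 : 0 < dist p (c t₀) := by
    have h : 0 < dist p (c t₀) ^ 2 := by rw [hR2]; positivity
    exact lt_of_le_of_ne dist_nonneg (by rintro h0; rw [← h0] at h; norm_num at h)
  have hD0 : 0 < dist d (c t₀) := hR0.trans_le hle
  -- the competitor in pencil coordinates: `d = c t₀ + u (q - p)`
  obtain ⟨u, hd⟩ : ∃ u : ℂ, d = c t₀ + u * (q - p) :=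
    ⟨(d - c t₀) / (q - p), by rw [div_mul_cancel₀ _ hv]; ring⟩
  have hD2 : ∀ t, dist d (c t) ^ 2 = ‖q - p‖ ^ 2 * (u.re ^ 2 + (u.im + t₀ - t) ^ 2) :=
    fun t => by rw [hd, hc, hc, pf_dist_d_sq]
  -- the two squared distances as quadratic polynomials in `t`
  have eD : ∀ t, dist d (c t) ^ 2 =
      ‖q - p‖ ^ 2 * (u.re ^ 2 + (u.im + t₀) ^ 2) + (-2 * ‖q - p‖ ^ 2 * (u.im + t₀)) * t
        + ‖q - p‖ ^ 2 * t ^ 2 := fun t => by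
    rw [hD2]; ring
  have eR : ∀ t, dist p (c t) ^ 2 =
      ‖q - p‖ ^ 2 / 4 + 0 * t + ‖q - p‖ ^ 2 * t ^ 2 := fun t => by
    rw [hR2]; ring
  have hfun : (fun t : ℝ => dist d (c t) - dist p (c t)) = fun t =>
      Real.sqrt (‖q - p‖ ^ 2 * (u.re ^ 2 + (u.im + t₀) ^ 2) + (-2 * ‖q - p‖ ^ 2 * (u.im + t₀)) * t
        + ‖q - p‖ ^ 2 * t ^ 2) - Real.sqrt (‖q - p‖ ^ 2 / 4 + 0 * t + ‖q - p‖ ^ 2 * t ^ 2) := by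
    funext t
    rw [← eD, ← eR, Real.sqrt_sq dist_nonneg, Real.sqrt_sq dist_nonneg]
  -- Fermat's rule at the local maximum `t₀`
  have hQD : ‖q - p‖ ^ 2 * (u.re ^ 2 + (u.im + t₀) ^ 2) + (-2 * ‖q - p‖ ^ 2 * (u.im + t₀)) * t₀
      + ‖q - p‖ ^ 2 * t₀ ^ 2 ≠ 0 := by
    rw [← eD]; exact pow_ne_zero 2 hD0.ne'
  have hQR : ‖q - p‖ ^ 2 / 4 + 0 * t₀ + ‖q - p‖ ^ 2 * t₀ ^ 2 ≠ 0 := by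
    rw [← eR]; exact pow_ne_zero 2 hR0.ne'
  have hderiv : HasDerivAt (fun t : ℝ => dist d (c t) - dist p (c t))
      ((-2 * ‖q - p‖ ^ 2 * (u.im + t₀) + 2 * (‖q - p‖ ^ 2) * t₀) /
          (2 * Real.sqrt (‖q - p‖ ^ 2 * (u.re ^ 2 + (u.im + t₀) ^ 2)
            + (-2 * ‖q - p‖ ^ 2 * (u.im + t₀)) * t₀ + ‖q - p‖ ^ 2 * t₀ ^ 2)) -
        (0 + 2 * (‖q - p‖ ^ 2) * t₀) /
          (2 * Real.sqrt (‖q - p‖ ^ 2 / 4 + 0 * t₀ + ‖q - p‖ ^ 2 * t₀ ^ 2))) t₀ := by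
    rw [hfun]
    exact ((pf_hasDerivAt_quad _ _ _ t₀).sqrt hQD).sub ((pf_hasDerivAt_quad _ _ _ t₀).sqrt hQR)
  have hzero := hmax.hasDerivAt_eq_zero hderiv
  rw [← eD, ← eR, Real.sqrt_sq dist_nonneg, Real.sqrt_sq dist_nonneg, sub_eq_zero,
    div_eq_div_iff (mul_pos two_pos hD0).ne' (mul_pos two_pos hR0).ne'] at hzero
  -- the ratio `s = D / R ≥ 1`
  obtain ⟨s, hs⟩ : ∃ s : ℝ, dist d (c t₀) = s * dist p (c t₀) :=
    ⟨dist d (c t₀) / dist p (c t₀), by rw [div_mul_cancel₀ _ hR0.ne']⟩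
  have hs1 : 1 ≤ s := by
    by_contra hlt
    have h1 : s * dist p (c t₀) < 1 * dist p (c t₀) :=
      mul_lt_mul_of_pos_right (not_le.mp hlt) hR0
    rw [← hs, one_mul] at h1
    exact absurd hle (not_le.mpr h1)
  -- `β R = -t₀ D`, hence `β = -t₀ s`
  have hβR : u.im * dist p (c t₀) = -(t₀ * dist d (c t₀)) := by
    apply mul_left_cancel₀ hN
    linear_combination (-1 / 4 : ℝ) * hzero
  have hβ : u.im = -(t₀ * s) := by
    apply mul_right_cancel₀ hR0.ne'
    rw [hβR, hs]; ring
  -- `α² = (s/2)²`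
  have hα2 : u.re ^ 2 = (s / 2) ^ 2 := by
    apply mul_left_cancel₀ hN
    have e1 := hD2 t₀
    have e2 := hR2 t₀
    linear_combination (-1 : ℝ) * e1 + s ^ 2 * e2 + (dist d (c t₀) + s * dist p (c t₀)) * hs
      - ‖q - p‖ ^ 2 * (u.im - t₀ * s) * hβ
  obtain hα | hα := sq_eq_sq_iff_eq_or_eq_neg.1 hα2
  · -- `α = s/2`: `d` is on the ray from `c t₀` through `q`, beyond `q`
    right
    have hu : u = (s : ℂ) * ((1/2 : ℂ) - (t₀ : ℂ) * Complex.I) := by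
      rw [← Complex.re_add_im u, hα, hβ]; push_cast; ring
    have hdq : d - q = ((s - 1 : ℝ) : ℂ) * (q - c t₀) := by
      rw [hd, hc, hu]; push_cast; ring
    rw [Complex.dist_eq, hdq, norm_mul, Complex.norm_real, Real.norm_eq_abs,
      abs_of_nonneg (by linarith), ← Complex.dist_eq, hRq, hs]
    ring
  · -- `α = -s/2`: `d` is on the ray from `c t₀` through `p`, beyond `p`
    left
    have hu : u = -(s : ℂ) * ((1/2 : ℂ) + (t₀ : ℂ) * Complex.I) := by
      rw [← Complex.re_add_im u, hα, hβ]; push_cast; ring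
    have hdp : d - p = ((s - 1 : ℝ) : ℂ) * (p - c t₀) := by
      rw [hd, hc, hu]; push_cast; ring
    rw [Complex.dist_eq, hdp, norm_mul, Complex.norm_real, Real.norm_eq_abs,
      abs_of_nonneg (by linarith), ← Complex.dist_eq, hs]
    ring

/-- **Fermat case of the pencil analysis** (stub `pencil_localMax_dist_eq` of the line
`moebius-exact-delaunay-dilation-ward`; Benjamini–Schramm 1998, Lemma 4.2).  For `p ≠ q` and the
pencil of centres `c t = p + (1/2 + t i)(q − p)` equidistant from `p` and `q`: if a competitor `d`
is not inside the disc at parameter `t₀` and the clearance `t ↦ dist d (c t) − dist p (c t)` has a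
local maximum at `t₀`, then `dist d p` or `dist d q` equals the clearance at `t₀` (the direction
from `c t₀` to `d` is the direction to `p` or to `q`). [folklore] -/
theorem pencil_localMax_dist_eq : ∀ (p q d : ℂ) (t₀ : ℝ), p ≠ q → dist p (p + ((1/2 : ℂ) + (t₀ : ℂ) * Complex.I) * (q - p)) ≤ dist d (p + ((1/2 : ℂ) + (t₀ : ℂ) * Complex.I) * (q - p)) → IsLocalMax (fun t : ℝ => dist d (p + ((1/2 : ℂ) + (t : ℂ) * Complex.I) * (q - p)) - dist p (p + ((1/2 : ℂ) + (t : ℂ) * Complex.I) * (q - p))) t₀ → (dist d p = dist d (p + ((1/2 : ℂ) + (t₀ : ℂ) * Complex.I) * (q - p)) - dist p (p + ((1/2 : ℂ) + (t₀ : ℂ) * Complex.I) * (q - p)) ∨ dist d q = dist d (p + ((1/2 : ℂ) + (t₀ : ℂ) * Complex.I) * (q - p)) - dist p (p + ((1/2 : ℂ) + (t₀ : ℂ) * Complex.I) * (q - p))) := by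
  intro p q d t₀ hpq hle hmax
  exact pf_core (fun t : ℝ => p + ((1/2 : ℂ) + (t : ℂ) * Complex.I) * (q - p)) (fun _ => rfl)
    hpq hle hmax

end Summit.CriticalPhenomena.CardyFormulaZ2.Cruxes.VoronoiHubFromSmirnov.MoebiusExactDelaunayDilationWard

end
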